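import Summits.BirchSwinnertonDyer.BirchSwinnertonDyer.Theorems.OneSidedTwistSqueezeX9KatoDivisibilityX9StubTestCocyclePkLevelX9InfRes
import HarnessLib

/-!
# Crux `KatoDivisibilityX9` (stmt-BirchSwinnertonDyer-20547), line `graded_euler_loss`, stub
# `stub_testCocyclePkLevelX9` (g5 wave 2), part 2: SURJECTIVITY of the inflation–restriction dictionary
# `H¹(K, M ⊗ Λ/(p^k, T^L)(κ⁻¹)) → H¹(K_∞, M)[(conj_γ − 1)^L]` (Greenberg's Lemma 3.2 at layer 0)

Seat `bsd-line-k6-p4` (prover-bsd-line-k6-p4-g5-0, stub worker A).  THEOREMS ONLY (no definition, no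
named fact, no `sorry`); `--supports stmt-BirchSwinnertonDyer-20547` helper; closes nothing.  Sequel of
`…StubTestCocyclePkLevelX9InfRes` (coordinate cocycles, `T ↔ conj_γ − 1`, injectivity).

For `κ` a `ℤ_p`-extension of a field `K` of characteristic `0` with topological generator `γ`,
`Γ_∞ = ker κ`, a discrete `Γ_K`-module `M` of exponent `p^k` with continuous orbit maps, and a discrete
Galois module `X` on `Fin L → M` (`0 < L`) with (hX) `Γ_∞` coordinatewise and (hγ)
`X γ x + S(X γ x) = (γ • x_i)_i`:

* `iterCocycle_class` — the iterated difference cocycles `c, γ·c(γ⁻¹·γ) − c, …` represent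
  `(conj_γ − 1)^[j] [c]`.
* **`exists_cocycle_of_iterate_conjH1_sub_eq_zero`** — for `c ∈ Z¹(Γ_∞, M)` with
  `(conj_γ − 1)^[L] [c] = 0` there are `ψ ∈ Z¹(Γ_K, X)` and cocycles `e_0, …, e_{L−1}` on `Γ_∞` with
  `e_{L−1} = c`, `e_i = γ·e_{i+1}(γ⁻¹·γ) − e_{i+1}` (`i + 1 < L`) and `ψ(τ)_i = e_i(τ)` on `Γ_∞`: the
  vector cocycle `F = (e_i)_i ∈ Z¹(Γ_∞, X)` satisfies `X(γ)F(γ⁻¹τγ) − F(τ) = (X(τ) − 1)m` with the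
  EXPLICIT `m = ((−1)^i m₀)_i`, `∂m₀ = (conj_γ − 1)^L c`, so the tree's cocycle-level Greenberg lemma
  `ZpExtension.exists_extend` (layer `n = 0`, `Gal(K̄/K_0) = Γ_K`) extends it to `Γ_K`.  The twisted
  `Γ_K`-action is placed on Mathlib's synonym `X.toRepresentation.asModule` LOCALLY in the proof.

Together with part 1 this is the level-`p^k` inverse-Shapiro dictionary the line card (Addendum g5)
asks for, in the `Γ_∞`-currency: `H¹(K, 𝒯^{(k)}_L(κ⁻¹)) ≅ H¹(K_∞, M)[(conj_γ − 1)^L]`, `T ↔ conj_γ − 1`.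

References: R. Greenberg, LNM 1716 (1999) §3 Lemma 3.2 [GreenbergLNM1716]; J.-P. Serre, *Galois
Cohomology* (1997) I §2.6 (b), I §3.4 [SerreGaloisCohomology1997]; L. Washington (1997) §13.1–13.2
[Washington1997].
-/

set_option autoImplicit false
-- the summit and its single problem are both named `BirchSwinnertonDyer` (registry layout D-0017)
set_option linter.dupNamespace false

noncomputable section

open scoped ContRepresentation
open Field Literature.NumberTheory.GaloisRepresentations Literature.NumberTheory.EllipticCurves
open Summit.BirchSwinnertonDyer.BirchSwinnertonDyer.Theorems.OneSidedTwistSqueezeX9KatoDivisibilityX9StubTestCocyclePkLevelX9InfRes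

universe u

namespace Summit.BirchSwinnertonDyer.BirchSwinnertonDyer.Theorems.OneSidedTwistSqueezeX9KatoDivisibilityX9StubTestCocyclePkLevelX9InfResSurj

variable {K : Type u} [Field K] [CharZero K] {p : ℕ} [Fact p.Prime] (κ : ZpExtension K p)
variable {M : Type u} [AddCommGroup M] [DistribMulAction (absoluteGaloisGroup K) M]
  [TopologicalSpace M] [DiscreteTopology M]

/-! ## Iterated difference cocycles -/

omit [CharZero K] in
/-- **Iterated differences represent `(conj_γ − 1)^j`.**  For a sequence of cocycles `e_j` on `Γ_∞`
with `e_{j+1} = γ·e_j(γ⁻¹·γ) − e_j` (`conjCocycle`), `[e_j] = (conj_γ − id)^[j] [e_0]`.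
[cite: SerreGaloisCohomology1997, I §2.5] -/
theorem iterCocycle_class (γ : absoluteGaloisGroup K)
    (f : ℕ → contOneCocycles (discreteTopRep κ.kerSubgroup M))
    (hf : ∀ j, f (j + 1) = conjCocycle κ.kerSubgroup γ (f j) - f j) (j : ℕ) :
    oneCocycleClass _ (f j) =
      (⇑(conjH1 κ.kerSubgroup M γ - AddMonoidHom.id (subgroupH1 κ.kerSubgroup M)))^[j]
        (oneCocycleClass _ (f 0)) := by
  induction j with
  | zero => rfl
  | succ j ih =>
    rw [Function.iterate_succ_apply', ← ih, hf, oneCocycleClass_sub, AddMonoidHom.sub_apply,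
      AddMonoidHom.id_apply, conjH1_oneCocycleClass]

/-! ## Surjectivity -/

variable {L : ℕ} (X : DiscreteGaloisModule K (Fin L → M))

omit [TopologicalSpace M] [DiscreteTopology M] in
/-- The alternating vector `((−1)^i m₀)_i` is sent by `1 + S` to `m₀ · T⁰`:
`((−1)^i m₀)_i + S((−1)^i m₀)_i = δ_0 m₀`. [cite: Washington1997, §13.1–§13.2] -/
theorem alternating_add_shiftEnd (hL : 0 < L) (m₀ : M) :
    (fun i : Fin L => ((-1 : ℤ) ^ (i : ℕ)) • m₀) +
        shiftEnd M L (fun i : Fin L => ((-1 : ℤ) ^ (i : ℕ)) • m₀) =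
      Pi.single (⟨0, hL⟩ : Fin L) m₀ := by
  funext i
  rw [Pi.add_apply, shiftEnd_apply, Pi.single_apply]
  by_cases h : (i : ℕ) = 0
  · rw [dif_pos h, if_pos (Fin.ext h), h, pow_zero, one_zsmul, add_zero]
  · rw [dif_neg h, if_neg (fun h' => h (by rw [h']))]
    dsimp only
    obtain ⟨n, hn⟩ := Nat.exists_eq_succ_of_ne_zero h
    rw [hn, Nat.succ_sub_one, pow_succ, mul_neg_one, neg_zsmul, neg_add_cancel]

/-- **Surjectivity of the dictionary onto the `(conj_γ − 1)^L`-torsion** (see the module docstring):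
from `c ∈ Z¹(Γ_∞, M)` with `(conj_γ − id)^[L] [c] = 0` to a cocycle `ψ ∈ Z¹(Γ_K, X)` whose coordinates on
`Γ_∞` are the iterated difference cocycles of `c` (top coordinate `= c`).
[cite: GreenbergLNM1716, §3 Lemma 3.2] [cite: SerreGaloisCohomology1997, I §2.6 (b)] -/
theorem exists_cocycle_of_iterate_conjH1_sub_eq_zero
    (hX : ∀ τ ∈ κ.kerSubgroup, ∀ x : Fin L → M, X τ x = fun i => τ • x i)
    {γ : absoluteGaloisGroup K} (hγ : κ.IsTopGenerator γ)
    (hγS : ∀ x : Fin L → M, X γ x + shiftEnd M L (X γ x) = fun i => γ • x i)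
    {k : ℕ} (hMk : ∀ m : M, p ^ k • m = 0) (hL : 0 < L)
    (c : contOneCocycles (discreteTopRep κ.kerSubgroup M))
    (hc : (⇑(conjH1 κ.kerSubgroup M γ - AddMonoidHom.id (subgroupH1 κ.kerSubgroup M)))^[L]
      (oneCocycleClass _ c) = 0) :
    ∃ (ψ : contOneCocycles X.toTopRep) (e : Fin L → contOneCocycles (discreteTopRep κ.kerSubgroup M)),
      e ⟨L - 1, Nat.sub_lt hL Nat.one_pos⟩ = c ∧
      (∀ (i : Fin L) (hi : (i : ℕ) + 1 < L),
        e i = conjCocycle κ.kerSubgroup γ (e ⟨(i : ℕ) + 1, hi⟩) - e ⟨(i : ℕ) + 1, hi⟩) ∧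
      ∀ (τ : κ.kerSubgroup) (i : Fin L), ψ.1 (τ : absoluteGaloisGroup K) i = (e i).1 τ := by
  -- the iterated differences `f j`, `f 0 = c`, and the coordinates `e i = f (L - 1 - i)`
  let f : ℕ → contOneCocycles (discreteTopRep κ.kerSubgroup M) :=
    fun j => Nat.rec c (fun _ d => conjCocycle κ.kerSubgroup γ d - d) j
  have hf0 : f 0 = c := rfl
  have hfs : ∀ j, f (j + 1) = conjCocycle κ.kerSubgroup γ (f j) - f j := fun j => rfl
  have hfL : oneCocycleClass _ (f L) = 0 := by
    rw [iterCocycle_class κ γ f hfs L, hf0, hc]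
  obtain ⟨m₀, hm₀⟩ := (oneCocycleClass_eq_zero_iff _ _).1 hfL
  let e : Fin L → contOneCocycles (discreteTopRep κ.kerSubgroup M) := fun i => f (L - 1 - i)
  have he_succ : ∀ (i : Fin L) (hi : (i : ℕ) + 1 < L),
      e i = conjCocycle κ.kerSubgroup γ (e ⟨(i : ℕ) + 1, hi⟩) - e ⟨(i : ℕ) + 1, hi⟩ := by
    intro i hi
    change f (L - 1 - i) = conjCocycle κ.kerSubgroup γ (f (L - 1 - (i + 1))) - f (L - 1 - (i + 1))
    rw [show L - 1 - (i : ℕ) = L - 1 - (i + 1) + 1 by omega, hfs]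
  -- pointwise: `γ • e_i(γ⁻¹τγ) = e_i τ + e_{i-1} τ` (`i ≥ 1`), `γ • e_0(γ⁻¹τγ) = e_0 τ + (τ m₀ − m₀)`
  have hconj_succ : ∀ (i : Fin L) (hi : (i : ℕ) + 1 < L) (τ : κ.kerSubgroup),
      γ • (e ⟨(i : ℕ) + 1, hi⟩).1 (subgroupConj κ.kerSubgroup γ τ) =
        (e ⟨(i : ℕ) + 1, hi⟩).1 τ + (e i).1 τ := by
    intro i hi τ
    have h := congrArg (fun d : contOneCocycles (discreteTopRep κ.kerSubgroup M) => d.1 τ) (he_succ i hi)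
    change (e i).1 τ = γ • (e ⟨(i : ℕ) + 1, hi⟩).1 (subgroupConj κ.kerSubgroup γ τ) -
      (e ⟨(i : ℕ) + 1, hi⟩).1 τ at h
    rw [h]
    abel
  have hconj_zero : ∀ τ : κ.kerSubgroup,
      γ • (e ⟨0, hL⟩).1 (subgroupConj κ.kerSubgroup γ τ) =
        (e ⟨0, hL⟩).1 τ + ((τ : absoluteGaloisGroup K) • m₀ - m₀) := by
    intro τ
    have h := hm₀ τ
    rw [show f L = conjCocycle κ.kerSubgroup γ (f (L - 1)) - f (L - 1) by
      rw [← hfs, Nat.sub_add_cancel hL]] at h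
    change γ • (f (L - 1)).1 (subgroupConj κ.kerSubgroup γ τ) - (f (L - 1)).1 τ =
      (τ : absoluteGaloisGroup K) • m₀ - m₀ at h
    change γ • (f (L - 1)).1 (subgroupConj κ.kerSubgroup γ τ) = (f (L - 1)).1 τ + _
    rw [← h]
    abel
  -- the synonym `X.asModule` with the twisted action, as a discrete `Γ_K`-module
  letI instX : DistribMulAction (absoluteGaloisGroup K) X.toRepresentation.asModule :=
    { smul := fun g x => X.toRepresentation g x
      one_smul := fun x => by
        change X.toRepresentation 1 x = x
        rw [map_one]; rfl
      mul_smul := fun g h x => by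
        change X.toRepresentation (g * h) x = X.toRepresentation g (X.toRepresentation h x)
        rw [map_mul]; rfl
      smul_zero := fun g => map_zero (X.toRepresentation g)
      smul_add := fun g x y => map_add (X.toRepresentation g) x y }
  letI tX : TopologicalSpace X.toRepresentation.asModule := Pi.topologicalSpace
  haveI dX : DiscreteTopology X.toRepresentation.asModule := Pi.discreteTopology
  have hsmul : ∀ (g : absoluteGaloisGroup K) (x : X.toRepresentation.asModule), g • x = X g x :=
    fun _ _ => rfl
  -- the vector cocycle `F = (e_i)_i` on `Γ_∞`
  let Ff : κ.kerSubgroup → X.toRepresentation.asModule := fun τ =>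
    (show (Fin L → M) from fun i => (e i).1 τ)
  have hFf : ∀ τ i, (Ff τ : Fin L → M) i = (e i).1 τ := fun _ _ => rfl
  have hFc : Continuous Ff := continuous_pi fun i => (e i).1.continuous
  let F : contOneCocycles (discreteTopRep κ.kerSubgroup X.toRepresentation.asModule) :=
    ⟨⟨Ff, hFc⟩, fun τ σ => by
      change (fun i => (e i).1 (τ * σ)) =
        (fun i => (e i).1 τ) + X (τ : absoluteGaloisGroup K) (fun i => (e i).1 σ)
      rw [hX _ τ.2]
      funext i
      change (e i).1 (τ * σ) = (e i).1 τ + (τ : absoluteGaloisGroup K) • (e i).1 σ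
      exact (e i).2 τ σ⟩
  have hF : ∀ τ : κ.kerSubgroup, F.1 τ = Ff τ := fun _ => rfl
  -- the correcting element `m = ((−1)^i m₀)_i`
  let m : X.toRepresentation.asModule :=
    (show (Fin L → M) from fun i : Fin L => ((-1 : ℤ) ^ (i : ℕ)) • m₀)
  have hm : ∀ τ : κ.kerSubgroup,
      γ ^ p ^ 0 • F.1 (subgroupConj κ.kerSubgroup (γ ^ p ^ 0) τ) - F.1 τ =
        (τ : absoluteGaloisGroup K) • m - m := by
    intro τ
    simp only [pow_zero, pow_one]
    -- the same identity in `Fin L → M`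
    change X γ (fun i => (e i).1 (subgroupConj κ.kerSubgroup γ τ)) - (fun i => (e i).1 τ) =
      X τ (fun i : Fin L => ((-1 : ℤ) ^ (i : ℕ)) • m₀) - (fun i : Fin L => ((-1 : ℤ) ^ (i : ℕ)) • m₀)
    rw [hX _ τ.2, ← sub_eq_zero]
    apply eq_zero_of_add_shiftEnd_eq_zero
    have hsplit : ∀ y y' : Fin L → M,
        y - y' + shiftEnd M L (y - y') = (y + shiftEnd M L y) - (y' + shiftEnd M L y') := by
      intro y y'
      rw [map_sub]
      abel
    rw [hsplit, hsplit, hsplit, hγS, shiftEnd_smul (τ : absoluteGaloisGroup K) (smul_zero _),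
      show ((fun i : Fin L => (τ : absoluteGaloisGroup K) • ((-1 : ℤ) ^ (i : ℕ)) • m₀) +
          fun i : Fin L => (τ : absoluteGaloisGroup K) •
            shiftEnd M L (fun j : Fin L => ((-1 : ℤ) ^ (j : ℕ)) • m₀) i) =
        fun i : Fin L => (τ : absoluteGaloisGroup K) •
          ((fun j : Fin L => ((-1 : ℤ) ^ (j : ℕ)) • m₀) +
            shiftEnd M L (fun j : Fin L => ((-1 : ℤ) ^ (j : ℕ)) • m₀)) i from by
        funext i; simp only [Pi.add_apply, smul_add],
      alternating_add_shiftEnd hL m₀]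
    funext i
    simp only [Pi.sub_apply, Pi.add_apply, Pi.zero_apply]
    by_cases hi0 : (i : ℕ) = 0
    · have hi : i = ⟨0, hL⟩ := Fin.ext hi0
      subst hi
      rw [hconj_zero τ, Pi.single_eq_same, shiftEnd_apply, dif_pos rfl]
      abel
    · have hi1 : (i : ℕ) - 1 + 1 < L := by omega
      have hieq : (⟨(i : ℕ) - 1 + 1, hi1⟩ : Fin L) = i := Fin.ext (by simp; omega)
      have hA := hconj_succ ⟨(i : ℕ) - 1, by omega⟩ hi1 τ
      rw [hieq] at hA
      rw [hA, Pi.single_apply, if_neg (fun h' => hi0 (by rw [h'])), smul_zero, shiftEnd_apply,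
        dif_neg hi0]
      abel
  -- hypotheses of Greenberg's lemma for the synonym
  have hcont : ∀ x : X.toRepresentation.asModule, Continuous fun g : absoluteGaloisGroup K => g • x :=
    fun x => X.continuous_apply_left x
  have hprim : ∀ x : X.toRepresentation.asModule, ∃ k' : ℕ, p ^ k' • x = 0 := by
    intro x
    refine ⟨k, ?_⟩
    funext i
    exact hMk ((x : Fin L → M) i)
  obtain ⟨b, hb⟩ := ZpExtension.exists_extend κ hγ 0 hcont hprim F m hm
  -- `Gal(K̄/K_0) = Γ_K`: turn `b` into a cocycle of `X` on `Γ_K`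
  have h0 : ∀ g : absoluteGaloisGroup K, g ∈ κ.layerSubgroup 0 := fun g => by
    rw [κ.layerSubgroup_zero]; exact Subgroup.mem_top g
  have hιc : Continuous fun g : absoluteGaloisGroup K => (⟨g, h0 g⟩ : κ.layerSubgroup 0) :=
    continuous_id.subtype_mk h0
  let ψf : absoluteGaloisGroup K → (Fin L → M) := fun g =>
    X.toRepresentation.asModuleEquiv (b.1 ⟨g, h0 g⟩)
  have hψc : Continuous ψf :=
    continuous_of_discreteTopology.comp (b.1.continuous.comp hιc)
  have he_top : e ⟨L - 1, Nat.sub_lt hL Nat.one_pos⟩ = c := by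
    change f (L - 1 - (L - 1)) = c
    rw [Nat.sub_self]
    exact hf0
  refine ⟨⟨⟨ψf, hψc⟩, fun g h => ?_⟩, e, he_top, he_succ, fun τ i => ?_⟩
  · change X.toRepresentation.asModuleEquiv (b.1 ⟨g * h, h0 (g * h)⟩) =
      X.toRepresentation.asModuleEquiv (b.1 ⟨g, h0 g⟩) +
        X g (X.toRepresentation.asModuleEquiv (b.1 ⟨h, h0 h⟩))
    have := b.2 ⟨g, h0 g⟩ ⟨h, h0 h⟩
    exact this
  · change (X.toRepresentation.asModuleEquiv (b.1 ⟨τ, h0 τ⟩) : Fin L → M) i = (e i).1 τ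
    have hbτ := hb τ τ.2
    rw [hF] at hbτ
    have : b.1 ⟨τ, h0 τ⟩ = Ff τ := hbτ
    rw [this]
    rfl

end Summit.BirchSwinnertonDyer.BirchSwinnertonDyer.Theorems.OneSidedTwistSqueezeX9KatoDivisibilityX9StubTestCocyclePkLevelX9InfResSurj

end
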